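import Summits.NavierStokesRegularity.NavierStokesRegularity.Theorems.StrainDoorsTypeITangentFieldTools
import Literature.Analysis.FluidPDE.ChaeWolfRemovingDSSLimit
import HarnessLib

/-!
# Strain doors, PART H — THE TANGENT VORTICITY FIELD OF A TYPE-I SOLUTION ATTAINS ITS VORTICITY NUMBER

(Tree file 2 of 2 of PART H — `typeI_tangent_field` (§H2) and §H3; §H1 and the §H2 toolkit are in
`StrainDoorsTypeITangentFieldTools`.  Text of nsreg-p1 g35 r58/StrainDoorsTypeITangentField.lean sha256
9c3ae5615613774d, split at the 400-line cap, bodies verbatim; the two uses of the local copy `tendsto_apply_of_tendsto'`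
now cite the tree original `ChaeWolf.tendsto_apply_of_tendsto` (one extra import), per the gate's dedup rule.)

`Summit.NavierStokesRegularity.NavierStokesRegularity.Theorems.StrainDoors` (continued; nsreg-p1 g35 ROUND-58, helper
lane of `stmt-NavierStokesRegularity-0056`, rung N0; lands after PART G `StrainDoorsTypeIRecentring`).  Second piece
of the proof programme for door D14 (`TypeIVorticityTangentRecord`, PART F): THE LIMIT.

* §H1 `window_transfer_fderiv_time`, `exists_uniform_gradLipschitz` — for the Type-I class
  `{classical on t < 0, ν = 1, f = 0, |u| ≤ C₀/(|x|+√−t)}` the velocity GRADIENT is `K₂(C₀)`-Lipschitz in space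
  and `L₁(C₀)`-Lipschitz in time on `t ≤ −1/4` (KNSS §4 (4.10)–(4.11) with `k = 1, 2` on windows, transferred
  from the smooth representative `U` of `u = U + b(t)` to `u` at every time; the `k = 1` twin of the tree's
  `ChaeWolf.exists_uniform_lipschitz`).
* §H2 ★★ `typeI_tangent_field` — KNSS's compactness step WITH GRADIENTS: a sequence `(u_n, p_n)` in the class has
  a subsequence with `u_{φ(n)} → v`, `∇u_{φ(n)} → ∇v` pointwise on `t ≤ −1/4` (pointwise Arzelà–Ascoli on the
  pairs `(u_n, ∇u_n)`; the limit gradient IS `∇v` by the uniform quadratic Taylor bound), `curl u_{φ(n)}(t,x_n) →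
  curl v(t,x₀)` along moving points, `v` Type-I, `∇v` jointly Lipschitz, and `t ↦ v(t − 1/4)` a bounded weak
  ancient solution (tree `isBoundedWeakNSSolutionOn_of_tendsto`, as in `ChaeWolf.exists_limit`).
* §H3 ★★★ `typeI_tangent_vorticity_attains` — for every member with `ω ≢ 0`: the vorticity number
  `W* = sup (0−s)|ω(s,y)| ∈ (0,∞)` is ATTAINED by the tangent field of the recentred family of PART G:
  **`|curl v(−1, z̄)| = W*`**, with `(0−s)|curl v(s,y)| ≤ W*` on `s ≤ −1/4` — the supremum of `u` is an interior
  space-time MAXIMUM of the scale-invariant vorticity of `v`.  No symmetry, no self-similarity, no hypothesis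
  beyond the class.  What door D14 asks beyond this file is only the LAW at `(−1, z̄)`, i.e. the vorticity
  equation for `v`; by KNSS Lemma 3.1 (tree `KNSS2009_regularity_boundedWeak_window_holds`) `v = U + b(t)` with
  `U` smooth and the INTEGRATED vorticity identity with drift `U + b` — the drift-tolerant record law is R59.

[cite: KochNadirashviliSereginSverak2009 §2 p. 5 (recentring/attainment), §4 (4.10)–(4.11), Lemma 6.1 and proof
of Thm 6.1 p. 12 (arXiv:0709.3599); ChaeWolf2017RemovingDSS §3 Step 2 (arXiv:1610.09464 pp. 8–9); GigaMiura2011 §2.1]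
-/

noncomputable section

open MeasureTheory Set Function Filter Metric Real InnerProductSpace
open _root_.Topology
open scoped ENNReal NNReal RealInnerProductSpace ContDiff Laplacian
open Literature.Analysis Literature.Analysis.FluidPDE
open Literature.Analysis.FluidPDE.VorticityDirectionDynamics

set_option linter.unusedVariables false
set_option linter.unusedSectionVars false

namespace Summit.NavierStokesRegularity.NavierStokesRegularity.Theorems.StrainDoors

open Summit.NavierStokesRegularity.NavierStokesRegularity.Theorems.ArgmaxDoors

/-! ## §H2 (continued) Extraction of the tangent field -/

/-- ★★ **The tangent field of a Type-I family (KNSS's compactness step, with gradients).**  Let `(u_n, p_n)`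
be classical solutions (`ν = 1`, `f = 0`) on `(−∞,0) × ℝ³` with a common Type-I bound `C₀`.  Then along a
subsequence `φ`, on `t ≤ −1/4`: `u_{φ(n)} → v` and `∇u_{φ(n)} → ∇v` POINTWISE, with `v(t,·)` differentiable,
`curl u_{φ(n)}(t, x_n) → curl v(t, x₀)` whenever `x_n → x₀`, `v` obeys the Type-I bound, and
`t ↦ v(t − 1/4)` is a bounded weak Navier–Stokes solution on `(−∞,0)`.  (Pointwise Arzelà–Ascoli
`exists_strictMono_tendsto_of_lipschitzWith` on the pairs `(u_n, ∇u_n)` frozen at `t = −1/4`, which are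
equi-Lipschitz by `ChaeWolf.exists_uniform_lipschitz` and `exists_uniform_gradLipschitz` and bounded by
`2C₀`, `K`; the limit gradient is `∇v` by the uniform quadratic Taylor bound; the weak form passes to the limit
by the tree's `isBoundedWeakNSSolutionOn_of_tendsto`, exactly as in `ChaeWolf.exists_limit`.)
[new-combination; cite: KochNadirashviliSereginSverak2009 §2 p. 5, Lemma 6.1, proof of Thm 6.1 (p. 12); ChaeWolf2017RemovingDSS §3 Step 2] -/
theorem typeI_tangent_field {C₀ : ℝ} (hC₀ : 0 ≤ C₀)
    {u : ℕ → ℝ → EuclideanSpace ℝ (Fin 3) → EuclideanSpace ℝ (Fin 3)}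
    {p : ℕ → ℝ → EuclideanSpace ℝ (Fin 3) → ℝ}
    (hcl : ∀ n, IsClassicalNSSolutionOn (Iio 0) 1 0 (u n) (p n)) (hI : ∀ n, HasTypeIDecay C₀ (u n)) :
    ∃ φ : ℕ → ℕ, StrictMono φ ∧
      ∃ v : ℝ → EuclideanSpace ℝ (Fin 3) → EuclideanSpace ℝ (Fin 3), Continuous (uncurry v) ∧
        (∀ t ≤ -(1 / 4 : ℝ), ∀ x, Tendsto (fun n => u (φ n) t x) atTop (𝓝 (v t x))) ∧
        (∀ t ≤ -(1 / 4 : ℝ), Differentiable ℝ (v t)) ∧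
        (∀ t ≤ -(1 / 4 : ℝ), ∀ x,
          Tendsto (fun n => fderiv ℝ (u (φ n) t) x) atTop (𝓝 (fderiv ℝ (v t) x))) ∧
        (∀ t ≤ -(1 / 4 : ℝ), ∀ (x : ℕ → EuclideanSpace ℝ (Fin 3)) (x₀ : EuclideanSpace ℝ (Fin 3)),
          Tendsto x atTop (𝓝 x₀) →
            Tendsto (fun n => curl (u (φ n) t) (x n)) atTop (𝓝 (curl (v t) x₀))) ∧
        (∀ t ≤ -(1 / 4 : ℝ), ∀ x, ‖v t x‖ ≤ C₀ / (‖x‖ + √(-t))) ∧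
        IsBoundedWeakNSSolutionOn (Iio 0) isOpen_Iio 1 (fun t => v (t - 1 / 4)) ∧
        (∃ K' : ℝ≥0, LipschitzWith K'
          (fun q : ℝ × EuclideanSpace ℝ (Fin 3) => fderiv ℝ (v (min q.1 (-(1 / 4 : ℝ)))) q.2)) := by
  obtain ⟨K, L, hK, hL, hKL⟩ := ChaeWolf.exists_uniform_lipschitz hC₀
  obtain ⟨K₂, L₁, hK₂, hL₁, hG⟩ := exists_uniform_gradLipschitz hC₀
  -- uniform bounds on `t ≤ -1/4`
  have hgradK : ∀ n, ∀ t ≤ -(1 / 4 : ℝ), ∀ x, ‖fderiv ℝ (u n t) x‖ ≤ K := fun n t ht x =>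
    norm_fderiv_le_of_dist_le hK ((hKL (hcl n) (hI n)).1 t ht) x
  -- the equi-Lipschitz family of pairs, frozen at `t = -1/4`
  set f : ℕ → ℝ × EuclideanSpace ℝ (Fin 3) →
      EuclideanSpace ℝ (Fin 3) × (EuclideanSpace ℝ (Fin 3) →L[ℝ] EuclideanSpace ℝ (Fin 3)) :=
    fun n q => (u n (min q.1 (-(1 / 4 : ℝ))) q.2, fderiv ℝ (u n (min q.1 (-(1 / 4 : ℝ)))) q.2) with hf
  have hlip : ∀ n, LipschitzWith (max (K + L).toNNReal (K₂ + L₁).toNNReal) (f n) := by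
    intro n
    have h1 := lipschitzWith_freeze (g := u n) hK hL (hKL (hcl n) (hI n)).1 (hKL (hcl n) (hI n)).2
    have h2 := lipschitzWith_freeze (g := fun t => fderiv ℝ (u n t)) hK₂ hL₁
      (hG (hcl n) (hI n)).1 (hG (hcl n) (hI n)).2
    exact h1.prodMk h2
  have hball : ∀ n q, f n q ∈ closedBall
      (0 : EuclideanSpace ℝ (Fin 3) × (EuclideanSpace ℝ (Fin 3) →L[ℝ] EuclideanSpace ℝ (Fin 3)))
      (max (2 * C₀) K) := by
    intro n q
    rw [mem_closedBall, dist_zero_right, Prod.norm_def]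
    exact max_le_max (ChaeWolf.typeI_norm_le_two_mul hC₀ (hI n) (min_le_right _ _) _)
      (hgradK n _ (min_le_right _ _) _)
  obtain ⟨φ, l, hφ, hl, -, hlim⟩ := exists_strictMono_tendsto_of_lipschitzWith f hlip hball
  -- the limit pair
  set v : ℝ → EuclideanSpace ℝ (Fin 3) → EuclideanSpace ℝ (Fin 3) := fun t x => (l (t, x)).1 with hv
  set A : ℝ → EuclideanSpace ℝ (Fin 3) → (EuclideanSpace ℝ (Fin 3) →L[ℝ] EuclideanSpace ℝ (Fin 3)) :=
    fun t x => (l (t, x)).2 with hAdef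
  have hf_of_le : ∀ n {t : ℝ} (ht : t ≤ -(1 / 4 : ℝ)) (x : EuclideanSpace ℝ (Fin 3)),
      f n (t, x) = (u n t x, fderiv ℝ (u n t) x) := fun n t ht x => by
    simp only [hf, min_eq_left ht]
  have hlimv : ∀ {t : ℝ} (ht : t ≤ -(1 / 4 : ℝ)) (x : EuclideanSpace ℝ (Fin 3)),
      Tendsto (fun n => u (φ n) t x) atTop (𝓝 (v t x)) := by
    intro t ht x
    have h := (continuous_fst.tendsto _).comp (hlim (t, x))
    have e : (fun n => u (φ n) t x) = Prod.fst ∘ fun n => f (φ n) (t, x) := by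
      funext n; simp only [comp_apply, hf_of_le _ ht]
    rw [e]; exact h
  have hlimA : ∀ {t : ℝ} (ht : t ≤ -(1 / 4 : ℝ)) (x : EuclideanSpace ℝ (Fin 3)),
      Tendsto (fun n => fderiv ℝ (u (φ n) t) x) atTop (𝓝 (A t x)) := by
    intro t ht x
    have h := (continuous_snd.tendsto _).comp (hlim (t, x))
    have e : (fun n => fderiv ℝ (u (φ n) t) x) = Prod.snd ∘ fun n => f (φ n) (t, x) := by
      funext n; simp only [comp_apply, hf_of_le _ ht]
    rw [e]; exact h
  -- the limit gradient is the gradient of the limit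
  have hderiv : ∀ {t : ℝ} (ht : t ≤ -(1 / 4 : ℝ)) (x : EuclideanSpace ℝ (Fin 3)),
      HasFDerivAt (v t) (A t x) x := by
    intro t ht x
    have ht0 : t ∈ Iio (0 : ℝ) := by simp only [mem_Iio]; linarith
    refine hasFDerivAt_of_tendsto_of_quadratic (K := K₂) (f := fun n => u (φ n) t)
      (A := fun n => fderiv ℝ (u (φ n) t) x) (fun n h => ?_) (fun y => hlimv ht y) (hlimA ht x)
    exact taylor_quadratic_of_fderiv_lipschitz (((hcl (φ n)).contDiff_velocity ht0).differentiable
      (by norm_cast)) hK₂ ((hG (hcl (φ n)) (hI (φ n))).1 t ht) x h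
  have hvc : Continuous (uncurry v) := by
    have e : uncurry v = Prod.fst ∘ l := by funext q; rfl
    rw [e]; exact continuous_fst.comp hl.continuous
  -- the frozen limit: `l (t,x) = l (t ∧ (-1/4), x)`, so the frozen gradient of `v` is `Prod.snd ∘ l`
  have hfreeze : ∀ q : ℝ × EuclideanSpace ℝ (Fin 3), l q = l (min q.1 (-(1 / 4 : ℝ)), q.2) := by
    intro q
    refine tendsto_nhds_unique (hlim q) ?_
    have e : (fun n => f (φ n) q) = fun n => f (φ n) (min q.1 (-(1 / 4 : ℝ)), q.2) := by
      funext n; simp only [hf, min_eq_left (min_le_right q.1 (-(1 / 4 : ℝ)))]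
    rw [e]; exact hlim _
  have hLipD : ∃ K' : ℝ≥0, LipschitzWith K'
      (fun q : ℝ × EuclideanSpace ℝ (Fin 3) => fderiv ℝ (v (min q.1 (-(1 / 4 : ℝ)))) q.2) := by
    have e : (fun q : ℝ × EuclideanSpace ℝ (Fin 3) => fderiv ℝ (v (min q.1 (-(1 / 4 : ℝ)))) q.2) =
        Prod.snd ∘ l := by
      funext q
      rw [comp_apply, hfreeze q]
      exact (hderiv (min_le_right _ _) q.2).fderiv
    exact ⟨_, e ▸ LipschitzWith.prod_snd.comp hl⟩
  refine ⟨φ, hφ, v, hvc, fun t ht x => hlimv ht x, fun t ht x => (hderiv ht x).differentiableAt,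
    fun t ht x => ?_, fun t ht x x₀ hx => ?_, fun t ht x => ?_, ?_, hLipD⟩
  · rw [(hderiv ht x).fderiv]; exact hlimA ht x
  · -- curl along moving points: `∇u_{φ n}(t,·)` is `K₂`-Lipschitz, uniformly in `n`
    have hgl : ∀ n, LipschitzWith (Real.toNNReal K₂) (fun y => fderiv ℝ (u (φ n) t) y) := fun n =>
      LipschitzWith.of_dist_le_mul fun a b => by
        rw [dist_eq_norm, dist_eq_norm, Real.coe_toNNReal K₂ hK₂]
        exact (hG (hcl (φ n)) (hI (φ n))).1 t ht a b
    have h1 : Tendsto (fun n => fderiv ℝ (u (φ n) t) (x n)) atTop (𝓝 (fderiv ℝ (v t) x₀)) := by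
      rw [(hderiv ht x₀).fderiv]
      exact ChaeWolf.tendsto_apply_of_tendsto hgl hx (hlimA ht x₀)
    have h2 := (curlCLM.continuous.tendsto _).comp h1
    simpa only [curl_eq_curlCLM, Function.comp_def] using h2
  · exact le_of_tendsto' (hlimv ht x).norm fun n => hI (φ n) t (by linarith) x
  · -- bounded weak solution on `(-∞, -1/4)`, shifted to `(-∞, 0)` (verbatim the tree's argument)
    have hA' : Tendsto (fun k : ℕ => -(k : ℝ) + -1) atTop atBot :=
      (tendsto_neg_atTop_atBot.comp tendsto_natCast_atTop_atTop).atBot_add tendsto_const_nhds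
    have e14 : ∀ t : ℝ, t - 1 / 4 = t + -(1 / 4 : ℝ) := fun t => by ring
    have hV : ∀ k : ℕ, IsBoundedWeakNSSolutionOn (Ioo (-(k : ℝ) + -1) 0) isOpen_Ioo 1
        (fun t => u (φ k) (t - 1 / 4)) := by
      intro k
      have hcl' : IsClassicalNSSolutionOn (Ioo (-(k : ℝ) + -1 + -(1 / 4)) (-(1 / 4))) 1 0
          (u (φ k)) (p (φ k)) :=
        (hcl (φ k)).mono (fun t ht => by simp only [mem_Iio]; linarith [ht.2])
          (uniqueDiffOn_Ioo _ _)
      have hbdd : IsBoundedOn (Ioo (-(k : ℝ) + -1 + -(1 / 4)) (-(1 / 4))) (u (φ k)) :=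
        ⟨2 * C₀, fun t ht x => ChaeWolf.typeI_norm_le_two_mul hC₀ (hI (φ k)) ht.2.le x⟩
      have h := (hcl'.isBoundedWeakNSSolutionOn hbdd).comp_add_right (-(1 / 4 : ℝ))
        (J := Ioo (-(k : ℝ) + -1) 0) isOpen_Ioo fun t => by
          simp only [mem_Ioo]
          constructor <;> intro h <;> constructor <;> linarith [h.1, h.2]
      simpa only [e14] using h
    have hcont : ∀ k : ℕ, ContinuousOn (uncurry fun t => u (φ k) (t - 1 / 4))
        (Ioo (-(k : ℝ) + -1) 0 ×ˢ univ) := by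
      intro k
      have h1 := ((hcl (φ k)).smooth_velocity.comp_add_right (-(1 / 4 : ℝ))).continuousOn
      refine (h1.mono (prod_mono (fun t ht => ?_) Subset.rfl)).congr fun q _ => by
        simp only [uncurry, e14]
      simp only [mem_preimage, mem_Iio]
      linarith [ht.2]
    have hbd : ∀ k : ℕ, ∀ t ∈ Ioo (-(k : ℝ) + -1) 0, ∀ x,
        ‖u (φ k) (t - 1 / 4) x‖ ≤ 2 * C₀ :=
      fun k t ht x => ChaeWolf.typeI_norm_le_two_mul hC₀ (hI (φ k)) (by linarith [ht.2]) x
    have hvc' : Continuous (uncurry fun t x => v (t - 1 / 4) x) :=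
      hvc.comp ((continuous_fst.sub continuous_const).prodMk continuous_snd)
    exact isBoundedWeakNSSolutionOn_of_tendsto hA' hV hcont hbd hvc'
      fun t ht x => hlimv (by linarith) x


/-! ## §H3 The tangent vorticity field of a Type-I solution ATTAINS its vorticity number -/

/-- `curl` of a slice with `K₂`-Lipschitz gradient is `‖curl‖K₂`-Lipschitz. [folklore] -/
theorem curl_sub_le_of_fderiv_lipschitz {f : EuclideanSpace ℝ (Fin 3) → EuclideanSpace ℝ (Fin 3)} {K₂ : ℝ}
    (hL : ∀ x y, ‖fderiv ℝ f x - fderiv ℝ f y‖ ≤ K₂ * ‖x - y‖) (x y : EuclideanSpace ℝ (Fin 3)) :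
    ‖curl f x - curl f y‖ ≤ ‖curlCLM‖ * K₂ * ‖x - y‖ := by
  rw [curl_eq_curlCLM, curl_eq_curlCLM, ← map_sub]
  calc ‖curlCLM (fderiv ℝ f x - fderiv ℝ f y)‖ ≤ ‖curlCLM‖ * ‖fderiv ℝ f x - fderiv ℝ f y‖ :=
        ContinuousLinearMap.le_opNorm _ _
    _ ≤ ‖curlCLM‖ * (K₂ * ‖x - y‖) := by gcongr; exact hL x y
    _ = ‖curlCLM‖ * K₂ * ‖x - y‖ := by ring

/-- ★★★ **The tangent vorticity field of a Type-I solution attains its vorticity number** (door D14, up to the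
law on the limit).  Let `(u,p)` be a classical solution of Navier–Stokes (`ν = 1`, `f = 0`) on `(−∞,0) × ℝ³` with
the Type-I bound `|u(t,x)| ≤ C₀/(|x| + √−t)` and `ω ≢ 0`.  Then the VORTICITY NUMBER
`W* := sup_{s<0,y} (0 − s)|ω(s,y)| ∈ (0,∞)` exists, and there are scales `λ_j > 0`, a point `z̄` and a field `v`
on `(−∞,−1/4] × ℝ³` — the TANGENT FIELD — such that: the recentred solutions `λ_j u(λ_j²·, λ_j·)` converge to
`v` pointwise TOGETHER WITH THEIR GRADIENTS (hence `ω_j → curl v`) on `t ≤ −1/4`; `v(t,·)` is differentiable,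
obeys the same Type-I bound, and `t ↦ v(t − 1/4)` is a bounded weak (KNSS) ancient solution; the vorticity
number of `v` on `s ≤ −1/4` is at most `W*`; and **`|curl v(−1, z̄)| = W*`: THE SUPREMUM OF `u` IS A MAXIMUM
OF THE TANGENT FIELD, attained at the interior point `(−1, z̄)`.**  (PART G's recentred family + §H2's
extraction + Bolzano–Weierstrass on the centres `|z_j| < R` + equi-Lipschitz vorticities at `t = −1`.)  This is
KNSS's move (arXiv:0709.3599 p. 5) carried out for `(0−t)|ω|` with no symmetry and no self-similarity; what
door D14 asks beyond it is only the REGULARITY/LAW of `v` at `(−1, z̄)` (R59: the drift form `v = U + b(t)`).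
[new-combination; cite: KochNadirashviliSereginSverak2009 §2 p. 5, §6; ChaeWolf2017RemovingDSS §3; GigaMiura2011 §2.1] -/
theorem typeI_tangent_vorticity_attains {C₀ : ℝ}
    {u : ℝ → EuclideanSpace ℝ (Fin 3) → EuclideanSpace ℝ (Fin 3)} {p : ℝ → EuclideanSpace ℝ (Fin 3) → ℝ}
    (hsol : IsClassicalNSSolutionOn (Iio 0) 1 0 u p) (hI : HasTypeIDecay C₀ u)
    (hcurl : ∃ t₀ : ℝ, t₀ < 0 ∧ ∃ x₀ : EuclideanSpace ℝ (Fin 3), curl (u t₀) x₀ ≠ 0) :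
    ∃ W : ℝ, 0 < W ∧ (∀ s : ℝ, s < 0 → ∀ y, (0 - s) * ‖curl (u s) y‖ ≤ W) ∧
      (∀ δ : ℝ, 0 < δ → ∃ s : ℝ, s < 0 ∧ ∃ y, W - δ < (0 - s) * ‖curl (u s) y‖) ∧
      ∃ lam : ℕ → ℝ, (∀ j, 0 < lam j) ∧
        ∃ v : ℝ → EuclideanSpace ℝ (Fin 3) → EuclideanSpace ℝ (Fin 3), ∃ zbar : EuclideanSpace ℝ (Fin 3),
          Continuous (uncurry v) ∧
          (∀ t ≤ -(1 / 4 : ℝ), ∀ x, Tendsto (fun j => nsRescale (lam j) u t x) atTop (𝓝 (v t x))) ∧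
          (∀ t ≤ -(1 / 4 : ℝ), Differentiable ℝ (v t)) ∧
          (∀ t ≤ -(1 / 4 : ℝ), ∀ x,
            Tendsto (fun j => fderiv ℝ (nsRescale (lam j) u t) x) atTop (𝓝 (fderiv ℝ (v t) x))) ∧
          (∀ t ≤ -(1 / 4 : ℝ), ∀ x,
            Tendsto (fun j => curl (nsRescale (lam j) u t) x) atTop (𝓝 (curl (v t) x))) ∧
          (∀ t ≤ -(1 / 4 : ℝ), ∀ x, ‖v t x‖ ≤ C₀ / (‖x‖ + √(-t))) ∧
          IsBoundedWeakNSSolutionOn (Iio 0) isOpen_Iio 1 (fun t => v (t - 1 / 4)) ∧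
          (∃ K' : ℝ≥0, LipschitzWith K'
            (fun q : ℝ × EuclideanSpace ℝ (Fin 3) => fderiv ℝ (v (min q.1 (-(1 / 4 : ℝ)))) q.2)) ∧
          (∀ s ≤ -(1 / 4 : ℝ), ∀ y, (0 - s) * ‖curl (v s) y‖ ≤ W) ∧
          ‖curl (v (-1)) zbar‖ = W := by
  have hC₀ : 0 ≤ C₀ := HasTypeIDecay.nonneg' hI
  obtain ⟨W, R, hW, hR, hbound, happ, lam, z, hfam⟩ := typeI_recentred_family hsol hI hcurl
  have hlam : ∀ j, 0 < lam j := fun j => (hfam j).1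
  have hz : ∀ j, ‖z j‖ < R := fun j => (hfam j).2.1
  have hcl : ∀ j, IsClassicalNSSolutionOn (Iio 0) 1 0 (nsRescale (lam j) u)
      (nsRescalePressure (lam j) p) := fun j => (hfam j).2.2.1
  have hIj : ∀ j, HasTypeIDecay C₀ (nsRescale (lam j) u) := fun j => (hfam j).2.2.2.1
  have hnum : ∀ j, ∀ s : ℝ, s < 0 → ∀ y, (0 - s) * ‖curl (nsRescale (lam j) u s) y‖ ≤ W :=
    fun j => (hfam j).2.2.2.2.1
  have hnear : ∀ j : ℕ, W - W / (j + 2) < ‖curl (nsRescale (lam j) u (-1)) (z j)‖ :=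
    fun j => (hfam j).2.2.2.2.2
  obtain ⟨φ, hφ, v, hvc, hlimv, hdiff, hlimD, hcurlmv, hvI, hweak, hLipD⟩ := typeI_tangent_field hC₀ hcl hIj
  -- Bolzano–Weierstrass on the centres
  obtain ⟨zbar, -, ψ, hψ, hzlim⟩ := tendsto_subseq_of_bounded (Metric.isBounded_ball (x := (0 :
    EuclideanSpace ℝ (Fin 3))) (r := R)) (x := fun n => z (φ n)) fun n => mem_ball_zero_iff.2 (hz (φ n))
  have hψ' : Tendsto ψ atTop atTop := hψ.tendsto_atTop
  -- uniform Lipschitz bound for the vorticities at `t = -1`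
  obtain ⟨K₂, L₁, hK₂, hL₁, hG⟩ := exists_uniform_gradLipschitz hC₀
  have h14 : (-1 : ℝ) ≤ -(1 / 4 : ℝ) := by norm_num
  refine ⟨W, hW, hbound, happ, fun j => lam (φ (ψ j)), fun j => hlam _, v, zbar, hvc,
    fun t ht x => (hlimv t ht x).comp hψ', hdiff, fun t ht x => (hlimD t ht x).comp hψ',
    fun t ht x => (hcurlmv t ht (fun _ => x) x tendsto_const_nhds).comp hψ', hvI, hweak, hLipD,
    fun s hs y => ?_, ?_⟩
  · -- the number of `v` is at most `W`
    have hs0 : s < 0 := by linarith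
    have hlim := ((hcurlmv s hs (fun _ => y) y tendsto_const_nhds).norm).const_mul (0 - s)
    exact le_of_tendsto' hlim fun n => hnum (φ n) s hs0 y
  · -- attainment at `(-1, zbar)`
    set T : ℕ → EuclideanSpace ℝ (Fin 3) :=
      fun j => curl (nsRescale (lam (φ (ψ j))) u (-1)) (z (φ (ψ j))) with hT
    -- `T j → curl v(-1, zbar)` : moving base points for the equi-Lipschitz vorticities
    have hgl : ∀ j, LipschitzWith (Real.toNNReal (‖curlCLM‖ * K₂))
        (fun y => curl (nsRescale (lam (φ (ψ j))) u (-1)) y) := fun j =>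
      LipschitzWith.of_dist_le_mul fun a b => by
        rw [dist_eq_norm, dist_eq_norm, Real.coe_toNNReal _ (by positivity)]
        exact curl_sub_le_of_fderiv_lipschitz ((hG (hcl _) (hIj _)).1 (-1) h14) a b
    have hfix : Tendsto (fun j => curl (nsRescale (lam (φ (ψ j))) u (-1)) zbar) atTop
        (𝓝 (curl (v (-1)) zbar)) :=
      (hcurlmv (-1) h14 (fun _ => zbar) zbar tendsto_const_nhds).comp hψ'
    have hconv : Tendsto T atTop (𝓝 (curl (v (-1)) zbar)) :=
      ChaeWolf.tendsto_apply_of_tendsto hgl hzlim hfix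
    -- the squeeze `W - W/(φψ j + 2) < ‖T j‖ ≤ W`
    have hup : ∀ j, ‖T j‖ ≤ W := fun j => by
      have h := hnum (φ (ψ j)) (-1) (by norm_num) (z (φ (ψ j)))
      norm_num at h
      exact h
    have hlowj : ∀ j, W - W / ((φ (ψ j) : ℝ) + 2) ≤ ‖T j‖ := fun j => (hnear (φ (ψ j))).le
    have hidx : Tendsto (fun j => ((φ (ψ j) : ℕ) : ℝ) + 2) atTop atTop :=
      tendsto_atTop_add_const_right _ _
        (tendsto_natCast_atTop_atTop.comp ((hφ.comp hψ).tendsto_atTop))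
    have hlow : Tendsto (fun j => W - W / ((φ (ψ j) : ℝ) + 2)) atTop (𝓝 W) := by
      have h0 : Tendsto (fun j => W / ((φ (ψ j) : ℝ) + 2)) atTop (𝓝 0) :=
        tendsto_const_nhds.div_atTop hidx
      simpa using (tendsto_const_nhds (x := W)).sub h0
    have hnormW : Tendsto (fun j => ‖T j‖) atTop (𝓝 W) :=
      tendsto_of_tendsto_of_tendsto_of_le_of_le hlow tendsto_const_nhds hlowj hup
    exact tendsto_nhds_unique hconv.norm hnormW

end Summit.NavierStokesRegularity.NavierStokesRegularity.Theorems.StrainDoors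

end
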